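import Mathlib
import Literature.MathematicalPhysics.QuantumFieldTheory.Balaban1983to89.B12StepObligation
import Literature.MathematicalPhysics.QuantumFieldTheory.Balaban1983to89.StepInhabited
import Literature.MathematicalPhysics.QuantumFieldTheory.Balaban1983to89.B12Inv329

/-!
# `Balaban1983to89.B12StepObligationOn` — the small-field step obligation of [Balaban1987RG1] Theorem 3 delivered FOR A
CLASS of gauge transformations, over an INHABITED step carrier: the class-relative form of `B12StepObligation`

CITATION HEADER (lean-in-tree rule 2026-08-18).  Sources: T. Bałaban, "Renormalization group approach to lattice gauge field
theories. I. Generation of effective actions in a small field approximation and a coupling constant renormalization in four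
dimensions", *Comm. Math. Phys.* **109**, 249–301 (1987) [Balaban1987RG1] (cell paper B12 = "[I]"; PDF page = journal page
− 248) and "II. Cluster expansions", *Comm. Math. Phys.* **116**, 1–22 (1988) [Balaban1988RG2Cluster] (B13 = "[II]";
journal page = PDF page).  Quotations are from the cell's page renders read as images by the typing seat
(`HOME/b2b-balaban-ref1/pages/1987-cmp109-rg-I-small-field/…-p015-x2.png`, `…-p028-x2.png`;
`…/1988-cmp116-rg-II-cluster/…-p011-x2.png`, `…-p021-x2.png`, `…-p022-x2.png`):
* [I] p. 263, (1.19): "E^{(j)}(X, g_{j−1}, 𝐔^u, R(u)𝐉) = E^{(j)}(X, g_{j−1}, 𝐔, 𝐉) for all G^c-valued gauge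
  transformations u", and after it: "The spaces U^c_j(X,α_0,α_1) are, by the definition, gauge invariant also."
* [I] p. 276, after (3.28): "The functions (3.25), (3.26) are gauge invariant with respect to the simultaneous gauge
  transformations  𝐔 → 𝐔^u, 𝐉 → R(u)𝐉, B → R(u)B,  (3.29)  for Gᶜ-valued transformations u in a sufficiently small
  neighborhood of G-valued transformations, so that the configurations after the transformations belong to proper spaces
  also."
* [II] p. 22: "We extend them to constant functions on whole orbits having non-empty intersections with the space".

WHAT THIS MODULE IS.  The module `B12StepObligation` (this lineage, p176804/p177122) assembles f2's per-step deliverable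
`Step.SFNewTerm T c k` — whose clause `gaugeInv119` is (1.19) at `j = k+1` for EVERY `u : 𝒢` — from [II]'s abstract clause
`B13.StepData.GaugeInv` through the dictionary field `StepDict.gauge_read`, which READS that abstract clause as invariance
under all of `𝒢`; and its run-level Part D binds `Tk : ∀ k, RTOp P k G (av k)`, a family type that is EMPTY for every
infinite compact `G` (cell DIVERGENCE F17; `AveragingRT.isEmpty_rtOp_family`), so those theorems are vacuous as typed.  Two
things have happened since: (a) the cell's adversarial reading GAPS G-adv7-7 locates that the printed delivery (3.29) holds
for BLOCK-CONSTANT `u` only, while the next step consumes (1.19) for fine `u` — the per-step GAUGE LIFT is an unprinted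
conjunct (typed by f2 as `Step.SFGaugeLift[S]`, module `StepInhabited` Part J, p179184; the algebra of the class by this
lineage's `B12Inv329`, p179217/p179278); (b) f2 made the step carrier inhabited (`RTOpI`, law-parametric forms
`SFStepObligationS` / `B12Thm3ShapeS` over an abstract one-step law, `StepInhabited` Parts I2/I3) and asked the instantiating
readers to MIGRATE (cell STEP.md v9 §7.9, §11 rows O-B1 / O-J1: "the class-relative conclusion `SFNewTermOn` they should now
target").  THIS MODULE IS THAT MIGRATION for the b03 lineage, additive (no existing file is touched):
* Part A — the CLASS-RELATIVE DICTIONARY `StepDictOn T c k S adm`: `StepDict` verbatim except that `gauge_read` is weakened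
  to `gauge_readOn`: [II]'s `GaugeInv` is read as (1.19) for the transformations `u` of the class `adm (k+1) X` only (for
  G-adv7-7: the block-constant class of `U_{k+1}(□₀, ·)`); `ofDict` (the all-`u` reading gives every class reading), `toDict`,
  `anti`.
* Part B — the clauses: `localDep_of_dictOn`, `bound118_of_dictOn` (by `B12StepObligation.bound118_transport`),
  `gaugeInv119On_of_dictOn`, the class-relative space clause `SpacesGaugeInvariantOn` (print gives it for all `u`, p. 263:
  `spacesGaugeInvariantOn_of_all`) and f2's structure `gaugeInvOn_of_dictOn : … → T.GaugeInvOn c adm (k+1)`.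
* Part C — THE CLASS-RELATIVE PER-STEP DELIVERABLE `sfNewTermOn_of_bound : … → Step.SFNewTermOn T c adm k` with the two
  readings (I.1.6) / (I.1.3) (`sfNewTermOn_of_deliverables`, `sfNewTermOn_of_bound241`); consistency with v1
  (`sfNewTermOn_of_dict`, `sfNewTerm_of_boundOn_allGauge`); and THE LOCATED LIFT at one step: `sfNewTerm_of_boundOn_of_lift`
  (hypothesis `T.GaugeInvOn c T.allGauge (k+1)`, f2's `SFNewTermOn.newTerm_of_lift`) and, through `B12Inv329` §8, its
  reduction to the PURELY FINE transformations `gaugeInvOn_allGauge_of_on_of_fine` / `sfNewTerm_of_boundOn_of_fine`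
  (hypotheses: (1.19) and the space clause on `ker bc` only — exactly the content G-adv7-7 finds unprinted).
* Part D — RUN LEVEL OVER AN ABSTRACT ONE-STEP LAW (inhabited carriers; any `law`, in particular f2's `smallFieldLawI Tk χ GF`
  over `RTOpI`): `sfStepObligationS_of_steps` / `b12Thm3ShapeS_of_steps` (law-parametric twins of v1 Part D),
  `sfStepObligationOnS_of_stepsOn`, `b12Thm3ShapeS_of_stepsOn_of_lift`, `sfStepObligationWithinS_of_stepsWithin` /
  `b12Thm3ShapeWithinS_of_stepsWithin`; THE WHOLE CHAIN class-relatively in the two architectures f2 typed: MIXED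
  (`b12Thm3ShapeS_of_deliverablesOn`: hypotheses for all `u` consumed at `k`, class-relative delivery at `k+1`, PLUS the named
  lift `SFGaugeLiftS law bg A T c adm K` = row O-J1 ⊢ `B12Thm3ShapeS`) and WITHIN (`b12Thm3ShapeWithinS_of_deliverablesOn`: no
  lift, weaker conclusion `B12Thm3ShapeWithinS … adm`); the fine form of the mixed chain (`…_of_fine`); the `RTOpI` instance
  (`b12Thm3ShapeI_of_deliverablesOn`) and v1's `RTOp` form recovered as the `smallFieldLaw` instance
  (`b12Thm3Shape_of_deliverablesOn`).
HONEST FRAMING: value = typed skeleton (migration of this lineage's step obligation to the inhabited, law-parametric carrier and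
to the class-relative conclusion, with the per-step gauge lift of G-adv7-7 as a NAMED hypothesis in three equivalent dresses),
NOT a proof of any estimate, NOT an adjudication of G-adv7-7, NOT summit progress.  Every `structure`/`def … : Prop` is consumed
as a hypothesis; every `theorem` is kernel-checked bookkeeping ([folklore]).  Zero `sorry`; axioms standard.
REVISION LOG.  v1 (b03-g5, 2026-08-18; cell GAPS C-b03g5-5, DIVERGENCE D-b03.17).
-/

namespace Literature.MathematicalPhysics.QuantumFieldTheory.Balaban1983to89.B12StepObligationOn

open Literature.MathematicalPhysics.QuantumFieldTheory.Balaban1983to89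
open Literature.MathematicalPhysics.QuantumFieldTheory.Balaban1983to89.Step
open Literature.MathematicalPhysics.QuantumFieldTheory.Balaban1983to89.B12StepObligation

variable {P : Params} {G : Type*} [GaugeGroup G] {Φ 𝒢 : Type*}

/-! ## Part A. The class-relative dictionary -/

/-- THE CLASS-RELATIVE DICTIONARY between [II]'s one-step carrier at the coupling value `g` and the tower at the new index
`k+1`: the fields of `B12StepObligation.StepDict` verbatim (see its docstring for the sourcing of each), except that the
reading of [II]'s abstract clause `GaugeInv` (Lemma 2 p. 11 "gauge invariant with respect to the simultaneous gauge
transformations (I.3.29)"; pp. 21–22) as (1.19) for the tower's action is asserted ONLY for the transformations `u` of the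
class `adm (k+1) X` — for the cell's reading G-adv7-7 the block-constant transformations of the unit-lattice step, for which
(3.29) p. 276 is printed-and-certified (`B12Inv329.Recipe.inv329At_of_isBlockConstant`).  Data, not a claim. [cite: Balaban1988RG2Cluster, Lemma 2 p.11; pp.21–22] -/
structure StepDictOn (T : SFTower P G Φ 𝒢) (c : SFConsts) (k : ℕ) (S : ℝ → B13.StepData)
    (adm : ∀ j, (T.sys j).Dom → 𝒢 → Prop) where
  ιX : (g : ℝ) → (T.sys (k+1)).Dom → (S g).Dk1.Dom
  ιφ : (g : ℝ) → Φ → (S g).Φ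
  dj_le : ∀ g X, (T.sys (k+1)).dj X ≤ (S g).Dk1.dj (ιX g X)
  mem_sp2 : ∀ g X φ, φ ∈ T.space (k+1) X c.α₀ c.α₁ → ιφ g φ ∈ (S g).sp2 (ιX g X)
  F : (g : ℝ) → (S g).Dk1.Dom → (S g).Φ → ℂ
  E_eq : ∀ g X φ, T.E (k+1) X g φ = F g (ιX g X) (ιφ g φ)
  local_read : ∀ g, (S g).Repr17 → ∀ X φ ψ, T.agreeOn (k+1) X φ ψ →
    F g (ιX g X) (ιφ g φ) = F g (ιX g X) (ιφ g ψ)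
  gauge_readOn : ∀ g X, (S g).GaugeInv (F g (ιX g X)) → ∀ u φ, adm (k+1) X u →
    F g (ιX g X) (ιφ g (T.act u φ)) = F g (ιX g X) (ιφ g φ)

namespace StepDictOn

variable {T : SFTower P G Φ 𝒢} {c : SFConsts} {k : ℕ} {S : ℝ → B13.StepData}

/-- The all-`u` reading of v1 (`StepDict.gauge_read`) gives the class reading for EVERY class. [folklore] -/
def ofDict (Δ : StepDict T c k S) (adm : ∀ j, (T.sys j).Dom → 𝒢 → Prop) : StepDictOn T c k S adm where
  ιX := Δ.ιX
  ιφ := Δ.ιφ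
  dj_le := Δ.dj_le
  mem_sp2 := Δ.mem_sp2
  F := Δ.F
  E_eq := Δ.E_eq
  local_read := Δ.local_read
  gauge_readOn := fun g X h u φ _ => Δ.gauge_read g X h u φ

/-- A class reading for a class containing every transformation at the new index is the all-`u` reading. [folklore] -/
def toDict {adm : ∀ j, (T.sys j).Dom → 𝒢 → Prop} (Δ : StepDictOn T c k S adm) (hall : ∀ X u, adm (k+1) X u) :
    StepDict T c k S where
  ιX := Δ.ιX
  ιφ := Δ.ιφ
  dj_le := Δ.dj_le
  mem_sp2 := Δ.mem_sp2
  F := Δ.F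
  E_eq := Δ.E_eq
  local_read := Δ.local_read
  gauge_read := fun g X h u φ => Δ.gauge_readOn g X h u φ (hall X u)

/-- The class reading is ANTITONE in the class. [folklore] -/
def anti {adm adm' : ∀ j, (T.sys j).Dom → 𝒢 → Prop} (Δ : StepDictOn T c k S adm)
    (hle : ∀ X u, adm' (k+1) X u → adm (k+1) X u) : StepDictOn T c k S adm' where
  ιX := Δ.ιX
  ιφ := Δ.ιφ
  dj_le := Δ.dj_le
  mem_sp2 := Δ.mem_sp2
  F := Δ.F
  E_eq := Δ.E_eq
  local_read := Δ.local_read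
  gauge_readOn := fun g X h u φ hu => Δ.gauge_readOn g X h u φ (hle X u hu)

/-- The representing family is unchanged by `ofDict`. [folklore] -/
@[simp] theorem ofDict_F (Δ : StepDict T c k S) (adm : ∀ j, (T.sys j).Dom → 𝒢 → Prop) : (ofDict Δ adm).F = Δ.F := rfl

/-- The representing family is unchanged by `toDict`. [folklore] -/
@[simp] theorem toDict_F {adm : ∀ j, (T.sys j).Dom → 𝒢 → Prop} (Δ : StepDictOn T c k S adm)
    (hall : ∀ X u, adm (k+1) X u) : (Δ.toDict hall).F = Δ.F := rfl

/-- The representing family is unchanged by `anti`. [folklore] -/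
@[simp] theorem anti_F {adm adm' : ∀ j, (T.sys j).Dom → 𝒢 → Prop} (Δ : StepDictOn T c k S adm)
    (hle : ∀ X u, adm' (k+1) X u → adm (k+1) X u) : (Δ.anti hle).F = Δ.F := rfl

end StepDictOn

/-! ## Part B. The clauses of `Step.SFNewTermOn T c adm k`, sourced -/

section Clauses

variable {T : SFTower P G Φ 𝒢} {c : SFConsts} {k : ℕ} {S : ℝ → B13.StepData}
  {adm : ∀ j, (T.sys j).Dom → 𝒢 → Prop}

/-- (1.7) at `j = k+1` from [II]'s `Repr17` through the class-relative dictionary (as `localDep_of_dict`). [cite: Balaban1988RG2Cluster, p.21 (representation (I.1.6)/(I.1.7) for A_{k+1})] -/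
theorem localDep_of_dictOn (Δ : StepDictOn T c k S adm) (hrepr : ∀ g, (S g).Repr17) :
    ∀ X g φ ψ, T.agreeOn (k+1) X φ ψ → T.E (k+1) X g φ = T.E (k+1) X g ψ := by
  intro X g φ ψ h
  rw [Δ.E_eq g X φ, Δ.E_eq g X ψ]
  exact Δ.local_read g (hrepr g) X φ ψ h

/-- (1.18) at `j = k+1` from [II] p. 21 "This yields the bounds (I.1.18) …" through the class-relative dictionary, by the
transport lemma of v1 (as `bound118_of_dict`). [cite: Balaban1988RG2Cluster, p.21 ("This yields the bounds (I.1.18)")] -/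
theorem bound118_of_dictOn (Δ : StepDictOn T c k S adm) {E₀' κ' : ℝ} (hE₀ : E₀' ≤ c.E₀) (hE₀' : 0 ≤ E₀')
    (hκ : c.κ ≤ κ') (hκ0 : 0 ≤ c.κ)
    (hbound : ∀ g, 0 ≤ g → g ≤ c.γ → B13.Bound118 (S g).Dk1 (S g).sp2 (Δ.F g) E₀' κ') :
    ∀ X g φ, 0 ≤ g → g ≤ c.γ → φ ∈ T.space (k+1) X c.α₀ c.α₁ →
      ‖T.E (k+1) X g φ‖ ≤ c.E₀ * Real.exp (-c.κ * (T.sys (k+1)).dj X) := by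
  intro X g φ hg0 hgγ hφ
  have h := bound118_transport (fun X => T.space (k+1) X c.α₀ c.α₁) (S g).sp2 (fun X φ => T.E (k+1) X g φ)
    (Δ.F g) (Δ.ιX g) (Δ.ιφ g) hE₀ hE₀' hκ hκ0 (Δ.dj_le g) (Δ.mem_sp2 g)
    (fun X φ _ => Δ.E_eq g X φ) (hbound g hg0 hgγ)
  exact h X φ hφ

/-- (1.19) at `j = k+1` FOR THE CLASS `adm` from [II]'s abstract `GaugeInv` through the class-relative reading — the
`gaugeInv119` field of f2's `T.GaugeInvOn c adm (k+1)`. [cite: Balaban1988RG2Cluster, pp.21–22 (gauge invariance (I.1.19))] -/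
theorem gaugeInv119On_of_dictOn (Δ : StepDictOn T c k S adm) (hgauge : ∀ g X, (S g).GaugeInv (Δ.F g X)) :
    ∀ X g u φ, adm (k+1) X u → T.E (k+1) X g (T.act u φ) = T.E (k+1) X g φ := by
  intro X g u φ hu
  rw [Δ.E_eq g X (T.act u φ), Δ.E_eq g X φ]
  exact Δ.gauge_readOn g X (hgauge g (Δ.ιX g X)) u φ hu

/-- The gauge invariance of the spaces at the index `j` FOR A CLASS (the `spaceInv` field of f2's `T.GaugeInvOn c adm j`);
print gives it for all `u` ([I] p. 263 "by the definition"), `spacesGaugeInvariantOn_of_all`. [cite: Balaban1987RG1, p.263 (after (1.19))] -/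
def SpacesGaugeInvariantOn (T : SFTower P G Φ 𝒢) (c : SFConsts) (adm : ∀ j, (T.sys j).Dom → 𝒢 → Prop) (j : ℕ) :
    Prop :=
  ∀ X u φ, adm j X u → φ ∈ T.space j X c.α₀ c.α₁ → T.act u φ ∈ T.space j X c.α₀ c.α₁

/-- v1's all-`u` space clause (`B12StepObligation.SpacesGaugeInvariant`, [I] p. 263) gives the class clause for every class. [folklore] -/
theorem spacesGaugeInvariantOn_of_all {T : SFTower P G Φ 𝒢} {c : SFConsts} {j : ℕ} (h : SpacesGaugeInvariant T c j)
    (adm : ∀ j, (T.sys j).Dom → 𝒢 → Prop) : SpacesGaugeInvariantOn T c adm j :=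
  fun X u φ _ hφ => h X u φ hφ

/-- … and for the class of all of `𝒢` the two coincide. [folklore] -/
theorem spacesGaugeInvariantOn_allGauge_iff (T : SFTower P G Φ 𝒢) (c : SFConsts) (j : ℕ) :
    SpacesGaugeInvariantOn T c T.allGauge j ↔ SpacesGaugeInvariant T c j :=
  ⟨fun h X u φ hφ => h X u φ trivial hφ, fun h => spacesGaugeInvariantOn_of_all h T.allGauge⟩

/-- f2's class-relative structure at the new index from the class-relative dictionary, [II]'s `GaugeInv` and the class
space clause. [folklore] -/
theorem gaugeInvOn_of_dictOn (Δ : StepDictOn T c k S adm) (hgauge : ∀ g X, (S g).GaugeInv (Δ.F g X))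
    (hsp : SpacesGaugeInvariantOn T c adm (k+1)) : T.GaugeInvOn c adm (k+1) where
  spaceInv := hsp
  gaugeInv119 := gaugeInv119On_of_dictOn Δ hgauge

end Clauses

/-! ## Part C. The class-relative per-step deliverable and the located lift at one step -/

section Deliverable

variable {T : SFTower P G Φ 𝒢} {c : SFConsts} {k : ℕ} {S : ℝ → B13.StepData}
  {adm : ∀ j, (T.sys j).Dom → 𝒢 → Prop}

/-- **THE CLASS-RELATIVE PER-STEP DELIVERABLE** (cell STEP.md v9 §11 O-B1/O-J1: "the class-relative conclusion `SFNewTermOn`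
they should now target"): from [II]'s bound of shape (I.1.18) for the representing family at every `g ∈ [0, γ]` with
comparable constants, [II]'s algebraic clauses `Repr17`/`GaugeInv`, the class-relative dictionary, (2.15), the class space
clause, the §5 source of the β-bound and the unsourced smoothness clause — `Step.SFNewTermOn T c adm k`: (1.19) and the
space clause for the class `adm` ONLY.  Kernel-checked bookkeeping; nothing of the series asserted. [cite: Balaban1988RG2Cluster, p.22 ("completes the proof of the inductive assumptions for the action A_{k+1}")] -/
theorem sfNewTermOn_of_bound (Δ : StepDictOn T c k S adm) {E₀' κ' : ℝ} (hE₀ : E₀' ≤ c.E₀) (hE₀' : 0 ≤ E₀')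
    (hκ : c.κ ≤ κ') (hκ0 : 0 ≤ c.κ)
    (hbound : ∀ g, 0 ≤ g → g ≤ c.γ → B13.Bound118 (S g).Dk1 (S g).sp2 (Δ.F g) E₀' κ')
    (hrepr : ∀ g, (S g).Repr17) (hgauge : ∀ g X, (S g).GaugeInv (Δ.F g X))
    (hrg : 1 / (T.flow.g k) ^ 2 = 1 / (T.flow.g (k+1)) ^ 2 + T.flow.β (k+1) (T.flow.g k))
    (hsp : SpacesGaugeInvariantOn T c adm (k+1)) (hβ : Beta542Source T c k) (hsmooth : BetaSmoothAt T c k) :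
    SFNewTermOn T c adm k where
  rg := hrg
  localDep := localDep_of_dictOn Δ hrepr
  bound118 := bound118_of_dictOn Δ hE₀ hE₀' hκ hκ0 hbound
  gaugeOn := gaugeInvOn_of_dictOn Δ hgauge hsp
  betaSmooth := hsmooth
  betaBound := betaBound_of_beta542 hβ

/-- **Reading (I.1.6)**, class-relative (`Δ.F g = StepData.Etot`; as `sfNewTerm_of_deliverables`). [cite: Balaban1988RG2Cluster, p.21 ("This yields the bounds (I.1.18) … in the representation (I.1.6) also")] -/
theorem sfNewTermOn_of_deliverables {c13 : B13.Consts} (Δ : StepDictOn T c k S adm) (hF : ∀ g, Δ.F g = (S g).Etot)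
    (hc : ConstsCompare c13 c) (hdel : ∀ g, 0 ≤ g → g ≤ c.γ → B13.Deliverables (S g) c13)
    (hrepr : ∀ g, (S g).Repr17) (hgauge : ∀ g X, (S g).GaugeInv ((S g).Etot X))
    (hrg : 1 / (T.flow.g k) ^ 2 = 1 / (T.flow.g (k+1)) ^ 2 + T.flow.β (k+1) (T.flow.g k))
    (hsp : SpacesGaugeInvariantOn T c adm (k+1)) (hβ : Beta542Source T c k) (hsmooth : BetaSmoothAt T c k) :
    SFNewTermOn T c adm k :=
  sfNewTermOn_of_bound Δ hc.E₀_le hc.E₀_nonneg hc.κ_le hc.κ_nonneg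
    (fun g hg0 hgγ => by rw [hF g]; exact (hdel g hg0 hgγ).bound) hrepr
    (fun g X => by rw [hF g]; exact hgauge g X) hrg hsp hβ hsmooth

/-- **Reading (I.1.3)**, class-relative (`Δ.F g = StepData.Ek1`, via [II] (2.41) and the two "last assumptions"
`B13.Consts.R22/R23`; as `sfNewTerm_of_bound241`). [cite: Balaban1988RG2Cluster, p.21 (after (2.41))] -/
theorem sfNewTermOn_of_bound241 {c13 : B13.Consts} (Δ : StepDictOn T c k S adm) (hF : ∀ g, Δ.F g = (S g).Ek1)
    (hc : ConstsCompare c13 c) (h241 : ∀ g, 0 ≤ g → g ≤ c.γ → B13.Bound241 (S g) c13) (h22 : c13.R22) (h23 : c13.R23)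
    (hrepr : ∀ g, (S g).Repr17) (hgauge : ∀ g X, (S g).GaugeInv ((S g).Ek1 X))
    (hrg : 1 / (T.flow.g k) ^ 2 = 1 / (T.flow.g (k+1)) ^ 2 + T.flow.β (k+1) (T.flow.g k))
    (hsp : SpacesGaugeInvariantOn T c adm (k+1)) (hβ : Beta542Source T c k) (hsmooth : BetaSmoothAt T c k) :
    SFNewTermOn T c adm k :=
  have hE : c13.E₀ / 2 ≤ c.E₀ := by linarith [hc.E₀_le, hc.E₀_nonneg]
  have hE' : 0 ≤ c13.E₀ / 2 := by linarith [hc.E₀_nonneg]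
  sfNewTermOn_of_bound Δ hE hE' hc.κ_le hc.κ_nonneg
    (fun g hg0 hgγ => by rw [hF g]; exact B13.bound118_of_bound241 (S g) c13 (h241 g hg0 hgγ) h22 h23) hrepr
    (fun g X => by rw [hF g]; exact hgauge g X) hrg hsp hβ hsmooth

/-- CONSISTENCY WITH v1: the all-`u` deliverable of `B12StepObligation.sfNewTerm_of_bound` gives the class-relative one for
every class (f2's `SFNewTerm.toOn`). [folklore] -/
theorem sfNewTermOn_of_dict (Δ : StepDict T c k S) {E₀' κ' : ℝ} (hE₀ : E₀' ≤ c.E₀) (hE₀' : 0 ≤ E₀')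
    (hκ : c.κ ≤ κ') (hκ0 : 0 ≤ c.κ)
    (hbound : ∀ g, 0 ≤ g → g ≤ c.γ → B13.Bound118 (S g).Dk1 (S g).sp2 (Δ.F g) E₀' κ')
    (hrepr : ∀ g, (S g).Repr17) (hgauge : ∀ g X, (S g).GaugeInv (Δ.F g X))
    (hrg : 1 / (T.flow.g k) ^ 2 = 1 / (T.flow.g (k+1)) ^ 2 + T.flow.β (k+1) (T.flow.g k))
    (hsp : SpacesGaugeInvariant T c (k+1)) (hβ : Beta542Source T c k) (hsmooth : BetaSmoothAt T c k)
    (adm : ∀ j, (T.sys j).Dom → 𝒢 → Prop) : SFNewTermOn T c adm k :=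
  (sfNewTerm_of_bound Δ hE₀ hE₀' hκ hκ0 hbound hrepr hgauge hrg hsp hβ hsmooth).toOn adm

/-- … and conversely the class-relative deliverable for the class of ALL of `𝒢` is v1's `SFNewTerm T c k`
(f2's `sfNewTerm_iff_on_allGauge`). [folklore] -/
theorem sfNewTerm_of_boundOn_allGauge (Δ : StepDictOn T c k S T.allGauge) {E₀' κ' : ℝ} (hE₀ : E₀' ≤ c.E₀)
    (hE₀' : 0 ≤ E₀') (hκ : c.κ ≤ κ') (hκ0 : 0 ≤ c.κ)
    (hbound : ∀ g, 0 ≤ g → g ≤ c.γ → B13.Bound118 (S g).Dk1 (S g).sp2 (Δ.F g) E₀' κ')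
    (hrepr : ∀ g, (S g).Repr17) (hgauge : ∀ g X, (S g).GaugeInv (Δ.F g X))
    (hrg : 1 / (T.flow.g k) ^ 2 = 1 / (T.flow.g (k+1)) ^ 2 + T.flow.β (k+1) (T.flow.g k))
    (hsp : SpacesGaugeInvariant T c (k+1)) (hβ : Beta542Source T c k) (hsmooth : BetaSmoothAt T c k) :
    SFNewTerm T c k :=
  (sfNewTerm_iff_on_allGauge T c k).mpr
    (sfNewTermOn_of_bound Δ hE₀ hE₀' hκ hκ0 hbound hrepr hgauge hrg (spacesGaugeInvariantOn_of_all hsp _) hβ hsmooth)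

/-- **THE LOCATED LIFT AT ONE STEP** (GAPS G-adv7-7 / STEP.md §11 O-J1 at the index `k+1`): the class-relative deliverable
TOGETHER WITH the gauge clauses at `k+1` for ALL of `𝒢` — the hypothesis `hlift`, discharged by whatever proves it (in the
cell's reading the unprinted re-gauging lemma R1; [II] p. 22's "extend them to constant functions on whole orbits"
presupposes it for fine `u`) — is v1's all-`u` deliverable `SFNewTerm T c k` (f2's `SFNewTermOn.newTerm_of_lift`). [folklore] -/
theorem sfNewTerm_of_boundOn_of_lift (Δ : StepDictOn T c k S adm) {E₀' κ' : ℝ} (hE₀ : E₀' ≤ c.E₀) (hE₀' : 0 ≤ E₀')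
    (hκ : c.κ ≤ κ') (hκ0 : 0 ≤ c.κ)
    (hbound : ∀ g, 0 ≤ g → g ≤ c.γ → B13.Bound118 (S g).Dk1 (S g).sp2 (Δ.F g) E₀' κ')
    (hrepr : ∀ g, (S g).Repr17) (hgauge : ∀ g X, (S g).GaugeInv (Δ.F g X))
    (hrg : 1 / (T.flow.g k) ^ 2 = 1 / (T.flow.g (k+1)) ^ 2 + T.flow.β (k+1) (T.flow.g k))
    (hsp : SpacesGaugeInvariantOn T c adm (k+1)) (hβ : Beta542Source T c k) (hsmooth : BetaSmoothAt T c k)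
    (hlift : T.GaugeInvOn c T.allGauge (k+1)) : SFNewTerm T c k :=
  (sfNewTermOn_of_bound Δ hE₀ hE₀' hκ hκ0 hbound hrepr hgauge hrg hsp hβ hsmooth).newTerm_of_lift hlift

end Deliverable

/-! ### C2. The lift reduced to the purely fine transformations (`B12Inv329` §8) -/

section Fine

open B12Inv329

variable [Group 𝒢] {T : SFTower P G Φ 𝒢} {c : SFConsts} {adm : ∀ j, (T.sys j).Dom → 𝒢 → Prop}

/-- AT ONE INDEX: f2's class-relative structure for a class CONTAINING the block-constant transformations `range bc` (`bc`
idempotent: `u ↦ ũ`), plus (1.19) and the space clause on the purely fine transformations `ker bc`, give the clauses for ALL of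
`𝒢` — under a multiplicative action (`u = ũ · (ũ⁻¹u)`, `B12Inv329.range_mul_ker_eq_univ`).  The fine-class hypotheses are
exactly what [I] p. 276 does not supply for (3.25) (G-adv7-7); nothing is asserted about them. [folklore] -/
theorem gaugeInvOn_allGauge_of_on_of_fine {j : ℕ} (hact : ActMul T) (bc : 𝒢 →* 𝒢) (hidem : ∀ u, bc (bc u) = bc u)
    (hadm : ∀ X u, adm j X (bc u)) (hOn : T.GaugeInvOn c adm j) (h119 : GaugeInv119On T j (bc.ker : Set 𝒢))
    (hsp : SpaceInvOn T c j (bc.ker : Set 𝒢)) : T.GaugeInvOn c T.allGauge j := by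
  have hle : ∀ X u, u ∈ Set.range bc → adm j X u := by
    rintro X u ⟨v, rfl⟩
    exact hadm X v
  refine gaugeInvOn_allGauge_of_univ ?_ ?_
  · exact (gaugeInv119On_univ_iff_range_and_ker hact j bc hidem).mpr ⟨gaugeInv119On_of_gaugeInvOn hOn hle, h119⟩
  · exact (spaceInvOn_univ_iff_range_and_ker hact j bc hidem).mpr ⟨spaceInvOn_of_gaugeInvOn hOn hle, hsp⟩

/-- Hence: the class-relative new-term obligation for such a class plus the fine-class clauses at `k+1` IS v1's all-`u`
obligation `SFNewTerm T c k`. [folklore] -/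
theorem sfNewTerm_of_on_of_fine {k : ℕ} (hact : ActMul T) (bc : 𝒢 →* 𝒢) (hidem : ∀ u, bc (bc u) = bc u)
    (hadm : ∀ X u, adm (k+1) X (bc u)) (hn : SFNewTermOn T c adm k)
    (h119 : GaugeInv119On T (k+1) (bc.ker : Set 𝒢)) (hsp : SpaceInvOn T c (k+1) (bc.ker : Set 𝒢)) :
    SFNewTerm T c k :=
  hn.newTerm_of_lift (gaugeInvOn_allGauge_of_on_of_fine hact bc hidem hadm hn.gaugeOn h119 hsp)

variable {k : ℕ} {S : ℝ → B13.StepData}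

/-- THE LOCATED LIFT AT ONE STEP IN ITS FINE DRESS: the class-relative deliverable from [II] for a class containing the
block-constant transformations, plus (1.19) and the space clause for the purely fine `u` at `k+1`, give `SFNewTerm T c k`. [folklore] -/
theorem sfNewTerm_of_boundOn_of_fine (hact : ActMul T) (bc : 𝒢 →* 𝒢) (hidem : ∀ u, bc (bc u) = bc u)
    (hadm : ∀ X u, adm (k+1) X (bc u)) (Δ : StepDictOn T c k S adm) {E₀' κ' : ℝ} (hE₀ : E₀' ≤ c.E₀)
    (hE₀' : 0 ≤ E₀') (hκ : c.κ ≤ κ') (hκ0 : 0 ≤ c.κ)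
    (hbound : ∀ g, 0 ≤ g → g ≤ c.γ → B13.Bound118 (S g).Dk1 (S g).sp2 (Δ.F g) E₀' κ')
    (hrepr : ∀ g, (S g).Repr17) (hgauge : ∀ g X, (S g).GaugeInv (Δ.F g X))
    (hrg : 1 / (T.flow.g k) ^ 2 = 1 / (T.flow.g (k+1)) ^ 2 + T.flow.β (k+1) (T.flow.g k))
    (hsp : SpacesGaugeInvariantOn T c adm (k+1)) (hβ : Beta542Source T c k) (hsmooth : BetaSmoothAt T c k)
    (h119 : GaugeInv119On T (k+1) (bc.ker : Set 𝒢)) (hspf : SpaceInvOn T c (k+1) (bc.ker : Set 𝒢)) :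
    SFNewTerm T c k :=
  sfNewTerm_of_on_of_fine hact bc hidem hadm
    (sfNewTermOn_of_bound Δ hE₀ hE₀' hκ hκ0 hbound hrepr hgauge hrg hsp hβ hsmooth) h119 hspf

end Fine

/-! ## Part D. Run level over an abstract one-step law (inhabited carriers) -/

section Run

variable {av : ∀ j, Averaging P j G}
variable (law : (k : ℕ) → ℝ → Density P k G → Density P (k+1) G → Prop) (bg : Background P G av)
  (A : ∀ k, Density P k G) (T : SFTower P G Φ 𝒢) (c : SFConsts) (adm : ∀ j, (T.sys j).Dom → 𝒢 → Prop) (K : ℕ)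

/-- LAW-PARAMETRIC TWIN of v1's `sfStepObligation_of_steps`: the per-step statements (interval hypothesis up to `k+1`) give
the obligation form over ANY one-step law (f2's `SFStepObligationS`, `StepInhabited` Part I2) — in particular over the
inhabited carrier `RTOpI` (`law := smallFieldLawI Tk χ GF`), where v1's binder `Tk : ∀ k, RTOp …` was vacuous for infinite
`G` (DIVERGENCE F17). [folklore] -/
theorem sfStepObligationS_of_steps
    (hstep : ∀ k, k < K → T.flow.InInterval c.γ (k+1) → SFHyp T c k → SFNewTerm T c k) :
    SFStepObligationS law bg A T c K :=
  fun _ hI k hk hH => hstep k hk (fun j hj => hI j (le_trans hj (Nat.succ_le_of_lt hk))) hH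

/-- … hence Theorem 3's shape over the law (f2's `B12Thm3ShapeS_iff_obligationS`; the induction is f2's). [folklore] -/
theorem b12Thm3ShapeS_of_steps
    (hstep : ∀ k, k < K → T.flow.InInterval c.γ (k+1) → SFHyp T c k → SFNewTerm T c k) :
    B12Thm3ShapeS law bg A T c K :=
  (B12Thm3ShapeS_iff_obligationS law bg A T c K).mpr (sfStepObligationS_of_steps law bg A T c K hstep)

/-- The class-relative per-step statements give f2's CLASS-RELATIVE OBLIGATION `SFStepObligationOnS … adm` (Part J2). [folklore] -/
theorem sfStepObligationOnS_of_stepsOn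
    (hstep : ∀ k, k < K → T.flow.InInterval c.γ (k+1) → SFHyp T c k → SFNewTermOn T c adm k) :
    SFStepObligationOnS law bg A T c adm K :=
  fun _ hI k hk hH => hstep k hk (fun j hj => hI j (le_trans hj (Nat.succ_le_of_lt hk))) hH

/-- MIXED ARCHITECTURE: class-relative per-step statements PLUS the per-step gauge lift over the law (f2's `SFGaugeLiftS`,
STEP.md §11 O-J1) give Theorem 3's shape (`b12Thm3ShapeS_of_on_of_lift`). [folklore] -/
theorem b12Thm3ShapeS_of_stepsOn_of_lift
    (hstep : ∀ k, k < K → T.flow.InInterval c.γ (k+1) → SFHyp T c k → SFNewTermOn T c adm k)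
    (hlift : SFGaugeLiftS law bg A T c adm K) : B12Thm3ShapeS law bg A T c K :=
  b12Thm3ShapeS_of_on_of_lift law bg A T c adm K (sfStepObligationOnS_of_stepsOn law bg A T c adm K hstep) hlift

/-- WITHIN ARCHITECTURE: per-step statements consuming AND delivering the clauses for the class only give f2's
`SFStepObligationWithinS … adm`. [folklore] -/
theorem sfStepObligationWithinS_of_stepsWithin
    (hstep : ∀ k, k < K → T.flow.InInterval c.γ (k+1) → SFHypOn T c adm k → SFNewTermOn T c adm k) :
    SFStepObligationWithinS law bg A T c adm K :=
  fun _ hI k hk hH => hstep k hk (fun j hj => hI j (le_trans hj (Nat.succ_le_of_lt hk))) hH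

/-- … hence the WEAKER shape `B12Thm3ShapeWithinS … adm` (conclusion `SFHypOn T c adm k`, k ≤ K; no lift needed; f2's
`b12Thm3ShapeWithinS_iff_obligationWithinS`). [folklore] -/
theorem b12Thm3ShapeWithinS_of_stepsWithin
    (hstep : ∀ k, k < K → T.flow.InInterval c.γ (k+1) → SFHypOn T c adm k → SFNewTermOn T c adm k) :
    B12Thm3ShapeWithinS law bg A T c adm K :=
  (b12Thm3ShapeWithinS_iff_obligationWithinS law bg A T c adm K).mpr
    (sfStepObligationWithinS_of_stepsWithin law bg A T c adm K hstep)

/-- **THE WHOLE CHAIN, CLASS-RELATIVE, MIXED ARCHITECTURE** (the printed architecture as the cell reads it, STEP.md v9 §5.2):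
for the sequence generated by the law with the couplings in the interval, IF at every step `k < K`, given the hypotheses at
`k` for ALL `u` (under which [II] works), [II] delivers its clauses at every `g ∈ [0, γ]` (`hdel`), the algebraic clauses hold
(`hrepr`, `hgauge`), the carriers are bound to the tower CLASS-RELATIVELY in the representation (I.1.6) (`Δ`, `hF`: [II]'s
`GaugeInv` read as (1.19) for `u ∈ adm (k+1) X` only), the constants compare, the spaces are gauge invariant for the class,
`β_{k+1}` has the §5 source, the unsourced smoothness clause holds, AND THE PER-STEP GAUGE LIFT `SFGaugeLiftS law bg A T c
adm K` HOLDS (`hlift` — STEP.md §11 O-J1, GAPS G-adv7-7's unprinted conjunct, named) — THEN Theorem 3's shape over the law is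
inhabited.  Every input is a hypothesis named by its printed source or by its located absence. [cite: Balaban1988RG2Cluster, p.1 and p.22 (completion of the proof of Thm I.3)] -/
theorem b12Thm3ShapeS_of_deliverablesOn (S : ℕ → ℝ → B13.StepData) (c13 : B13.Consts)
    (Δ : ∀ k, StepDictOn T c k (S k) adm) (hF : ∀ k g, (Δ k).F g = (S k g).Etot) (hc : ConstsCompare c13 c)
    (hdel : ∀ k, k < K → SFHyp T c k → T.flow.InInterval c.γ (k+1) →
      ∀ g, 0 ≤ g → g ≤ c.γ → B13.Deliverables (S k g) c13)
    (hrepr : ∀ k g, (S k g).Repr17) (hgauge : ∀ k g X, (S k g).GaugeInv ((S k g).Etot X))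
    (hsp : ∀ k, k < K → SpacesGaugeInvariantOn T c adm (k+1))
    (hβ : ∀ k, k < K → Beta542Source T c k) (hsmooth : ∀ k, k < K → BetaSmoothAt T c k)
    (hlift : SFGaugeLiftS law bg A T c adm K) :
    B12Thm3ShapeS law bg A T c K := by
  refine b12Thm3ShapeS_of_on_of_lift law bg A T c adm K ?_ hlift
  intro hgen hI k hk hH
  have hIk : T.flow.InInterval c.γ (k+1) := fun j hj => hI j (le_trans hj (Nat.succ_le_of_lt hk))
  exact sfNewTermOn_of_deliverables (Δ k) (hF k) hc (hdel k hk hH hIk) (hrepr k) (hgauge k)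
    (rg_of_satisfiesRG hgen.rg hk) (hsp k hk) (hβ k hk) (hsmooth k hk)

/-- **THE WHOLE CHAIN, CLASS-RELATIVE, WITHIN ARCHITECTURE** (B15-§1-style; STEP.md v9 §11 O-J1 "or avoid it by proving the
within-class obligation"): IF [II] delivers its clauses given only the CLASS-RELATIVE hypotheses `SFHypOn T c adm k` at `k`
(`hdel` — a STRONGER demand on the step than the printed one, which consumes (1.19) for fine `u`: (2.6) p. 266, (3.3) p. 270,
(3.37)–(3.38) pp. 277–278), then the weaker shape `B12Thm3ShapeWithinS … adm` is inhabited, with NO lift.  A shape for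
comparison; which architecture the print realises is the object of G-adv7-7, not asserted. [cite: Balaban1987RG1, Thm 3 p.264] -/
theorem b12Thm3ShapeWithinS_of_deliverablesOn (S : ℕ → ℝ → B13.StepData) (c13 : B13.Consts)
    (Δ : ∀ k, StepDictOn T c k (S k) adm) (hF : ∀ k g, (Δ k).F g = (S k g).Etot) (hc : ConstsCompare c13 c)
    (hdel : ∀ k, k < K → SFHypOn T c adm k → T.flow.InInterval c.γ (k+1) →
      ∀ g, 0 ≤ g → g ≤ c.γ → B13.Deliverables (S k g) c13)
    (hrepr : ∀ k g, (S k g).Repr17) (hgauge : ∀ k g X, (S k g).GaugeInv ((S k g).Etot X))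
    (hsp : ∀ k, k < K → SpacesGaugeInvariantOn T c adm (k+1))
    (hβ : ∀ k, k < K → Beta542Source T c k) (hsmooth : ∀ k, k < K → BetaSmoothAt T c k) :
    B12Thm3ShapeWithinS law bg A T c adm K := by
  refine (b12Thm3ShapeWithinS_iff_obligationWithinS law bg A T c adm K).mpr ?_
  intro hgen hI k hk hH
  have hIk : T.flow.InInterval c.γ (k+1) := fun j hj => hI j (le_trans hj (Nat.succ_le_of_lt hk))
  exact sfNewTermOn_of_deliverables (Δ k) (hF k) hc (hdel k hk hH hIk) (hrepr k) (hgauge k)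
    (rg_of_satisfiesRG hgen.rg hk) (hsp k hk) (hβ k hk) (hsmooth k hk)

/-- THE MIXED CHAIN IN ITS FINE DRESS: for a class containing the block-constant transformations of each new scale
(`bc (k+1)`, idempotent) and a multiplicative action, the lift hypothesis is replaced by (1.19) and the space clause on the
PURELY FINE transformations `ker (bc (k+1))` at every new index (`B12Inv329.sfGaugeLift_of_fine`) — the content the cell
finds unprinted at [I] p. 276 (G-adv7-7), as two named hypotheses. [folklore] -/
theorem b12Thm3ShapeS_of_deliverablesOn_of_fine [Group 𝒢] (hact : B12Inv329.ActMul T) (bc : ℕ → (𝒢 →* 𝒢))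
    (hidem : ∀ j u, bc j (bc j u) = bc j u) (hadm : ∀ j X u, adm j X (bc j u))
    (S : ℕ → ℝ → B13.StepData) (c13 : B13.Consts)
    (Δ : ∀ k, StepDictOn T c k (S k) adm) (hF : ∀ k g, (Δ k).F g = (S k g).Etot) (hc : ConstsCompare c13 c)
    (hdel : ∀ k, k < K → SFHyp T c k → T.flow.InInterval c.γ (k+1) →
      ∀ g, 0 ≤ g → g ≤ c.γ → B13.Deliverables (S k g) c13)
    (hrepr : ∀ k g, (S k g).Repr17) (hgauge : ∀ k g X, (S k g).GaugeInv ((S k g).Etot X))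
    (hsp : ∀ k, k < K → SpacesGaugeInvariantOn T c adm (k+1))
    (hβ : ∀ k, k < K → Beta542Source T c k) (hsmooth : ∀ k, k < K → BetaSmoothAt T c k)
    (hfine119 : ∀ k, k < K → B12Inv329.GaugeInv119On T (k+1) ((bc (k+1)).ker : Set 𝒢))
    (hfineSp : ∀ k, k < K → B12Inv329.SpaceInvOn T c (k+1) ((bc (k+1)).ker : Set 𝒢)) :
    B12Thm3ShapeS law bg A T c K :=
  b12Thm3ShapeS_of_deliverablesOn law bg A T c adm K S c13 Δ hF hc hdel hrepr hgauge hsp hβ hsmooth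
    (fun _ _ => B12Inv329.sfGaugeLift_of_fine hact bc hidem hadm hfine119 hfineSp)

/-- **MIGRATION OF v1's `b12Thm3Shape_of_deliverables`** (all-`u` dictionary `StepDict`, as printed-read by v1) to the
law-parametric shape `B12Thm3ShapeS` over ANY one-step law — the non-vacuous form of v1 Part D (cell STEP.md v9 §7.9
MIGRATION STATUS). [cite: Balaban1988RG2Cluster, p.1 and p.22 (completion of the proof of Thm I.3)] -/
theorem b12Thm3ShapeS_of_deliverables (S : ℕ → ℝ → B13.StepData) (c13 : B13.Consts)
    (Δ : ∀ k, StepDict T c k (S k)) (hF : ∀ k g, (Δ k).F g = (S k g).Etot) (hc : ConstsCompare c13 c)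
    (hdel : ∀ k, k < K → SFHyp T c k → T.flow.InInterval c.γ (k+1) →
      ∀ g, 0 ≤ g → g ≤ c.γ → B13.Deliverables (S k g) c13)
    (hrepr : ∀ k g, (S k g).Repr17) (hgauge : ∀ k g X, (S k g).GaugeInv ((S k g).Etot X))
    (hsp : ∀ k, k < K → SpacesGaugeInvariant T c (k+1))
    (hβ : ∀ k, k < K → Beta542Source T c k) (hsmooth : ∀ k, k < K → BetaSmoothAt T c k) :
    B12Thm3ShapeS law bg A T c K := by
  refine (B12Thm3ShapeS_iff_obligationS law bg A T c K).mpr ?_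
  intro hgen hI k hk hH
  have hIk : T.flow.InInterval c.γ (k+1) := fun j hj => hI j (le_trans hj (Nat.succ_le_of_lt hk))
  exact sfNewTerm_of_deliverables (Δ k) (hF k) hc (hdel k hk hH hIk) (hrepr k) (hgauge k)
    (rg_of_satisfiesRG hgen.rg hk) (hsp k hk) (hβ k hk) (hsmooth k hk)

variable [MeasurableSpace G] [HaarData G]

/-- THE `RTOpI` INSTANCE (f2's inhabited carrier, `StepInhabited` Part I3: `B12Thm3ShapeI Tk χ GF … :=
B12Thm3ShapeS (smallFieldLawI Tk χ GF) …`): v1's whole chain over the inhabited small-field law. [folklore] -/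
theorem b12Thm3ShapeI_of_deliverables (Tk : ∀ k, RTOpI P k G (av k)) (χ GF : ∀ k, Density P k G)
    (S : ℕ → ℝ → B13.StepData) (c13 : B13.Consts)
    (Δ : ∀ k, StepDict T c k (S k)) (hF : ∀ k g, (Δ k).F g = (S k g).Etot) (hc : ConstsCompare c13 c)
    (hdel : ∀ k, k < K → SFHyp T c k → T.flow.InInterval c.γ (k+1) →
      ∀ g, 0 ≤ g → g ≤ c.γ → B13.Deliverables (S k g) c13)
    (hrepr : ∀ k g, (S k g).Repr17) (hgauge : ∀ k g X, (S k g).GaugeInv ((S k g).Etot X))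
    (hsp : ∀ k, k < K → SpacesGaugeInvariant T c (k+1))
    (hβ : ∀ k, k < K → Beta542Source T c k) (hsmooth : ∀ k, k < K → BetaSmoothAt T c k) :
    B12Thm3ShapeI Tk χ GF bg A T c K :=
  b12Thm3ShapeS_of_deliverables (smallFieldLawI Tk χ GF) bg A T c K S c13 Δ hF hc hdel hrepr hgauge hsp hβ hsmooth

/-- THE `RTOpI` INSTANCE of the class-relative mixed chain. [folklore] -/
theorem b12Thm3ShapeI_of_deliverablesOn (Tk : ∀ k, RTOpI P k G (av k)) (χ GF : ∀ k, Density P k G)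
    (S : ℕ → ℝ → B13.StepData) (c13 : B13.Consts)
    (Δ : ∀ k, StepDictOn T c k (S k) adm) (hF : ∀ k g, (Δ k).F g = (S k g).Etot) (hc : ConstsCompare c13 c)
    (hdel : ∀ k, k < K → SFHyp T c k → T.flow.InInterval c.γ (k+1) →
      ∀ g, 0 ≤ g → g ≤ c.γ → B13.Deliverables (S k g) c13)
    (hrepr : ∀ k g, (S k g).Repr17) (hgauge : ∀ k g X, (S k g).GaugeInv ((S k g).Etot X))
    (hsp : ∀ k, k < K → SpacesGaugeInvariantOn T c adm (k+1))
    (hβ : ∀ k, k < K → Beta542Source T c k) (hsmooth : ∀ k, k < K → BetaSmoothAt T c k)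
    (hlift : SFGaugeLiftS (smallFieldLawI Tk χ GF) bg A T c adm K) :
    B12Thm3ShapeI Tk χ GF bg A T c K :=
  b12Thm3ShapeS_of_deliverablesOn (smallFieldLawI Tk χ GF) bg A T c adm K S c13 Δ hF hc hdel hrepr hgauge hsp hβ hsmooth
    hlift

/-- … and v1's `RTOp`-carrier conclusion `B12Thm3Shape av Tk …` recovered as the `smallFieldLaw` instance (f2's
`B12Thm3Shape_iff_steps`; vacuous binder for infinite `G`, kept for comparison with v1 only). [folklore] -/
theorem b12Thm3Shape_of_deliverablesOn (Tk : ∀ k, RTOp P k G (av k)) (χ GF : ∀ k, Density P k G)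
    (S : ℕ → ℝ → B13.StepData) (c13 : B13.Consts)
    (Δ : ∀ k, StepDictOn T c k (S k) adm) (hF : ∀ k g, (Δ k).F g = (S k g).Etot) (hc : ConstsCompare c13 c)
    (hdel : ∀ k, k < K → SFHyp T c k → T.flow.InInterval c.γ (k+1) →
      ∀ g, 0 ≤ g → g ≤ c.γ → B13.Deliverables (S k g) c13)
    (hrepr : ∀ k g, (S k g).Repr17) (hgauge : ∀ k g X, (S k g).GaugeInv ((S k g).Etot X))
    (hsp : ∀ k, k < K → SpacesGaugeInvariantOn T c adm (k+1))
    (hβ : ∀ k, k < K → Beta542Source T c k) (hsmooth : ∀ k, k < K → BetaSmoothAt T c k)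
    (hlift : SFGaugeLiftS (smallFieldLaw av Tk χ GF) bg A T c adm K) :
    B12Thm3Shape av Tk χ GF bg A T c K :=
  (B12Thm3Shape_iff_steps av Tk χ GF bg A T c K).mpr
    (b12Thm3ShapeS_of_deliverablesOn (smallFieldLaw av Tk χ GF) bg A T c adm K S c13 Δ hF hc hdel hrepr hgauge hsp hβ
      hsmooth hlift)

end Run

end Literature.MathematicalPhysics.QuantumFieldTheory.Balaban1983to89.B12StepObligationOn
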